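/-
Copyright (c) 2026. All rights reserved.
Released under Apache 2.0 license as described in the file LICENSE.
Authors: abc-iut cell, prover seat abc-iut-w5-d096 (gen 8; abc-iut-L4-lead m134 «ALPHA-FACT-NAME»: the punctured cell's
closer with its topological binder (α) read through the NAMED classical fact `PuncturedCompactRiemannSurfaceFreePi1`).
-/
import Literature.AnabelianGeometry.AbsoluteAnabelian.ArchimedeanHolFieldFunctorGeometricPSLPlaneComplFiniteType
import Literature.AlgebraicTopology.FundamentalGroup.PuncturedSurfaceFreeFundamentalGroup
import HarnessLib

/-!
# [AbsTopIII] Prop 4.2 (i) / Cor 4.5 at every non-compact Riemann surface of finite type, MODULO THE NAMED FACT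
# `PuncturedCompactRiemannSurfaceFreePi1` only (PROOF-ONLY)

S. Mochizuki, *Topics in Absolute Anabelian Geometry III*, proof of Prop 4.2 (i) p.106, Cor 4.5 pp.107–109, Cor 2.4 p.54
[MochizukiAbsTopIII2015]; W. S. Massey, *Algebraic Topology: An Introduction*, Ch. 4 §5 [Massey1967AlgebraicTopology].

The zero-cusp-residual closer `HolRS.isIdRigid_EA_and_cor_4_5_full_mapsTo_of_isOfFiniteType` (part 3 of row
«PUNCTURED-HIGHER-GENUS-IDRIGID») has hypotheses {finite type, non-compact, `hπ : IsFreeOrSurface (π₁ X)`, `hab`}.  This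
file rewrites `hπ` through the named classical fact (α) := `PuncturedCompactRiemannSurfaceFreePi1` («`π₁` of a punctured
compact Riemann surface is free of finite rank», Massey Ch. 4 §5 — statement-only in the tree), transported along the
finite-type witness `X ≅ X̄ ∖ S`:

* `HolRS.isFreeOfFiniteRank_fundamentalGroup_of_isOfFiniteType` — (α) ⇒ `π₁(X, x₀)` free of finite rank for every
  non-compact `X` of finite type (`S ≠ ∅` from non-compactness, `X̄ ∖ S` connected as the image of `X`, transport by
  `Homeomorph.fundamentalGroupMulEquiv`);
* ★ `HolRS.isIdRigid_EA_and_cor_4_5_full_mapsTo_of_isOfFiniteType_of_freePi1` (+ RC twin) — Prop 4.2 (i) id-rigidity of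
  «objects of `EA` mapping to `X`» ∧ `Cor_4_5_full` at EVERY non-compact connected Riemann surface of finite type with
  non-abelian `π₁`, CONDITIONAL on the single named fact (α) and nothing else (the gate records a conditional result; the
  fact is classical — CW structure / classification of compact surfaces — and campaign-L to prove).

No definition, no instance; the named fact is consumed BY NAME as a hypothesis `(H : PuncturedCompactRiemannSurfaceFreePi1)`.
HONEST FRAMING: classical; MODEL side of [AbsTopIII] §4; nothing here bears on the disputed [IUTchIII] Cor. 3.12.
-/

set_option autoImplicit false

noncomputable section

namespace Literature.AnabelianGeometry.AbsoluteAnabelian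

namespace HolRS

open scoped _root_.Manifold _root_.ContDiff _root_.Topology
open _root_.Function _root_.CategoryTheory _root_.TopologicalSpace _root_.Set
open Literature.IUT.HodgeTheaters (IsFreeOrSurface IsFreeOfFiniteRank)
open Literature.AlgebraicTopology.FundamentalGroup (PuncturedCompactRiemannSurfaceFreePi1)

variable (X : HolRS)

/-- **(α) at every non-compact Riemann surface of finite type**: under the named fact
`PuncturedCompactRiemannSurfaceFreePi1` (Massey Ch. 4 §5), the fundamental group of a non-compact `X` of finite type is
free of finite rank — unpack the witness `e : X ≅ X̄ ∖ S` (`S ≠ ∅` since `X` is not compact; `X̄ ∖ S` connected as the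
image of `X`) and transport `π₁` along the homeomorphism `e`. [cite: Massey1967AlgebraicTopology, Ch. 4 §5]
[cite: MochizukiAbsTopIII2015, Corollary 2.4 p.54] -/
theorem isFreeOfFiniteRank_fundamentalGroup_of_isOfFiniteType (H : PuncturedCompactRiemannSurfaceFreePi1)
    (hX : IsOfFiniteType X.carrier) (hnc : ¬ CompactSpace X.carrier) (x₀ : X.carrier) :
    IsFreeOfFiniteRank (FundamentalGroup X.carrier x₀) := by
  obtain ⟨⟨Xc, S, e, -, -⟩⟩ := hX
  -- `S ≠ ∅` since `X` is not compact
  have hne : ((S : Set Xc)).Nonempty := by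
    rw [Finset.coe_nonempty]
    by_contra h
    rw [Finset.not_nonempty_iff_eq_empty] at h
    subst h
    apply hnc
    haveI : CompactSpace
        ((⟨(((∅ : Finset Xc) : Set Xc))ᶜ, (∅ : Finset Xc).finite_toSet.isClosed.isOpen_compl⟩ :
          Opens Xc) : Type) := by
      refine isCompact_iff_compactSpace.mp ?_
      change IsCompact ((((∅ : Finset Xc) : Set Xc))ᶜ)
      rw [Finset.coe_empty, Set.compl_empty]
      exact isCompact_univ
    exact e.symm.compactSpace
  -- `X̄ ∖ S` is connected (continuous image of the connected `X`)
  have hconn : IsConnected (((S : Set Xc))ᶜ) := by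
    have hr : Set.range (Subtype.val ∘ e) = ((S : Set Xc))ᶜ := by
      rw [e.surjective.range_comp]
      exact Subtype.range_coe
    rw [← hr]
    exact isConnected_range (continuous_subtype_val.comp e.continuous)
  -- the named fact at `X̄ ∖ S`, transported along `e`
  have h : IsFreeOfFiniteRank (FundamentalGroup _ (e x₀)) := H Xc (S : Set Xc) S.finite_toSet hne hconn (e x₀)
  exact IsFreeOfFiniteRank.of_mulEquiv (e.fundamentalGroupMulEquiv rfl) h

/-- ★ **[AbsTopIII] Prop 4.2 (i) id-rigidity + `Cor_4_5_full` at EVERY non-compact connected Riemann surface of finite type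
with non-abelian `π₁`, MODULO the named classical fact (α) `PuncturedCompactRiemannSurfaceFreePi1` ONLY** (holomorphic
morphisms): part 3's zero-cusp-residual closer with `hπ` read through (α).
[cite: MochizukiAbsTopIII2015, Proposition 4.2 (i) proof p.106] [cite: MochizukiAbsTopIII2015, Corollary 4.5 pp.107–109]
[cite: Massey1967AlgebraicTopology, Ch. 4 §5] -/
theorem isIdRigid_EA_and_cor_4_5_full_mapsTo_of_isOfFiniteType_of_freePi1 (H : PuncturedCompactRiemannSurfaceFreePi1)
    (hX : IsOfFiniteType X.carrier) (hnc : ¬ CompactSpace X.carrier) (x₀ : X.carrier)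
    (hab : ∃ a b : FundamentalGroup X.carrier x₀, a * b ≠ b * a) :
    IsIdRigid (geometricAutHolFieldFunctor fun Y : HolRS => Nonempty (Y ⟶ X)).EA ∧
      AbsTopIII.Cor_4_5_full
        (archLogFrobeniusData (geometricAutHolFieldFunctor fun Y : HolRS => Nonempty (Y ⟶ X)))
        (archTelecoreData (geometricAutHolFieldFunctor fun Y : HolRS => Nonempty (Y ⟶ X))) :=
  X.isIdRigid_EA_and_cor_4_5_full_mapsTo_of_isOfFiniteType hX hnc x₀
    (Or.inl (X.isFreeOfFiniteRank_fundamentalGroup_of_isOfFiniteType H hX hnc x₀)) hab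

/-- ★ **The same for print's RC-holomorphic morphisms**, modulo (α) only.
[cite: MochizukiAbsTopIII2015, Proposition 4.2 (i) proof p.106] [cite: Massey1967AlgebraicTopology, Ch. 4 §5] -/
theorem RC.isIdRigid_EA_and_cor_4_5_full_mapsTo_of_isOfFiniteType_of_freePi1
    (H : PuncturedCompactRiemannSurfaceFreePi1) (hX : IsOfFiniteType X.carrier) (hnc : ¬ CompactSpace X.carrier)
    (x₀ : X.carrier) (hab : ∃ a b : FundamentalGroup X.carrier x₀, a * b ≠ b * a) :
    IsIdRigid (geometricAutHolFieldFunctorRC fun Y : RC => Nonempty (Y ⟶ toRC.obj X)).EA ∧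
      AbsTopIII.Cor_4_5_full
        (archLogFrobeniusData (geometricAutHolFieldFunctorRC fun Y : RC => Nonempty (Y ⟶ toRC.obj X)))
        (archTelecoreData (geometricAutHolFieldFunctorRC fun Y : RC => Nonempty (Y ⟶ toRC.obj X))) :=
  RC.isIdRigid_EA_and_cor_4_5_full_mapsTo_of_isOfFiniteType X hX hnc x₀
    (Or.inl (X.isFreeOfFiniteRank_fundamentalGroup_of_isOfFiniteType H hX hnc x₀)) hab

end HolRS

end Literature.AnabelianGeometry.AbsoluteAnabelian

end
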